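import Literature.AlgebraicGeometry.Motives.SegreEmbedding
import Literature.AlgebraicGeometry.Motives.ProjectiveSpaceComplexPointsCohomology
import Literature.AlgebraicGeometry.HodgeTheory.HolomorphicBundleChernCharacterProjectiveSpace
import Literature.AlgebraicGeometry.HodgeTheory.ComplexBettiKunneth
import Literature.Topology.FourManifolds.ComplexProjectiveSpaceHomologyProofs
import Literature.AlgebraicTopology.SingularHomology.UniversalCoefficientsField
import Literature.AlgebraicGeometry.HodgeTheory.RationalClassesIndependent
import HarnessLib

/-!
# Crux `WeilTwelvefoldsSqrtMinus7` (stmt-HodgeConjecture-1261), line `amnesic-secant-sheaves-split-fourteenfolds` — lemmas for stub `stub_symmetricSegreEmbedding` (β, r6), part I: the two slices of `(ℙⁿ ×_ℂ ℙᵐ)(ℂ)` detect `H²`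

Helper file of the stub `stub_symmetricSegreEmbedding` (the `K`-symmetric weighted Segre embedding of
`A × (E × E)`; E. Markman, arXiv:2509.23403 §11.5 Step 2; R. Hartshorne, *Algebraic Geometry* II
Ex. 5.11–5.12, `σ^*𝒪(1) = 𝒪(1,1)`). The Betti side of the Segre embedding is computed in part II by
comparing classes on the two slices `ℙⁿ × {Q}` and `{P} × ℙᵐ` of the product of complex points; this
file proves that **the two slices detect `H²((ℙⁿ ×_ℂ ℙᵐ)(ℂ); ℂ)`** (`segreSlices_detect`): the joint
restriction map to `H²(ℙⁿ(ℂ)) ⊕ H²(ℙᵐ(ℂ))` is onto (pull-backs along the projections), and both sides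
have the same dimension by the Künneth count `b₂(ℙⁿ × ℙᵐ) = b₂ b₀ + b₁ b₁ + b₀ b₂` of the tree
(`finrank_complexBetti_tensor`) with `b₀(ℙᴺ(ℂ)) = 1`, `b₁(ℙᴺ(ℂ)) = 0` (universal coefficients over a
field and `H₁(ℂℙᴺ) = 0`, transported along `ℙᴺ_ℂ(ℂ) ≃ₜ ℂℙᴺ`). The slices are the continuous maps
`P ↦ (P, Q)`, `Q ↦ (P, Q)` through `AlgPoints.prodEquiv` (Conrad's homeomorphism
`(X ×_ℂ Y)(ℂ) ≃ₜ X(ℂ) × Y(ℂ)`). Also here, for part II: two rational classes on a complex line differ by a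
RATIONAL factor (`exists_ratCast_eq_of_isRationalClass_smul`, from the tree's
`linearIndependent_of_isRationalClass`). Everything is proved; no named fact is taken.
-/

noncomputable section

-- every declaration of this problem lives in `Summit.HodgeConjecture.HodgeConjecture.…`
set_option linter.dupNamespace false

open CategoryTheory AlgebraicGeometry MonoidalCategory CartesianMonoidalCategory Function
open Literature.AlgebraicGeometry Literature.AlgebraicGeometry.Motives
  Literature.AlgebraicGeometry.HodgeTheory Literature.AlgebraicTopology.SingularHomology

namespace Summit.HodgeConjecture.HodgeConjecture.Theorems.WeilTwelvefoldsSqrtMinus7.AmnesicSecantSheaves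

/-! ## Betti numbers `b₀ = 1`, `b₁ = 0` of `ℙᴺ_ℂ(ℂ)` -/

/-- `H¹(ℂℙᴺ; ℂ) = 0` (universal coefficients over a field and `H₁(ℂℙᴺ) = 0`).
[cite: HatcherAT2002, §3.1 Thm. 3.2 and §2.2 p. 140] -/
theorem finrank_singularCohomology_one_complexProjectiveSpace (N : ℕ) :
    Module.finrank ℂ (singularCohomology ℂ ℂ (Literature.Topology.FourManifolds.ComplexProjectiveSpace N) 1) = 0 := by
  have hz := ((Literature.Topology.FourManifolds.singularHomology_complexProjectiveSpace_of_module ℂ ℂ N 1).2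
    (fun h ↦ by obtain ⟨⟨r, hr⟩, -⟩ := h; omega))
  haveI : Subsingleton (singularHomology ℂ ℂ (Literature.Topology.FourManifolds.ComplexProjectiveSpace N) 1) :=
    ModuleCat.subsingleton_of_isZero hz
  rw [(LinearEquiv.ofBijective _ (kroneckerPairing_bijective_of_field ℂ
    (Literature.Topology.FourManifolds.ComplexProjectiveSpace N) 1)).finrank_eq]
  exact Module.finrank_zero_of_subsingleton

/-- `b₀(ℙᴺ_ℂ(ℂ)) = 1`. [cite: HatcherAT2002, §3.1 p. 199] -/
theorem finrank_complexBetti_projectiveSpace_zero (N : ℕ) :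
    Module.finrank ℂ (complexBetti (projectiveSpace N ℂ) 0) = 1 := by
  haveI := Literature.Topology.FourManifolds.ComplexProjectiveSpace.pathConnectedSpace N
  rw [← Literature.Topology.FourManifolds.ComplexProjectiveSpace.finrank_singularCohomology_zero (K := ℂ)
    (X := Literature.Topology.FourManifolds.ComplexProjectiveSpace N)]
  exact (singularCohomology.mapIso ℂ ℂ (complexPointsProjectiveSpaceHomeomorph N) 0).toLinearEquiv.finrank_eq.symm

/-- `b₁(ℙᴺ_ℂ(ℂ)) = 0`. [cite: HatcherAT2002, Thm. 3.19] -/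
theorem finrank_complexBetti_projectiveSpace_one (N : ℕ) :
    Module.finrank ℂ (complexBetti (projectiveSpace N ℂ) 1) = 0 := by
  rw [← finrank_singularCohomology_one_complexProjectiveSpace N]
  exact (singularCohomology.mapIso ℂ ℂ (complexPointsProjectiveSpaceHomeomorph N) 1).toLinearEquiv.finrank_eq.symm

/-! ## Maps through a point kill `H²` -/

/-- A map factoring through a point induces `0` on `H²` (`H²(pt) = 0`).
[cite: HatcherAT2002, §3.1 p. 199] -/
theorem map_two_eq_zero_of_factors {X Y : Type} [TopologicalSpace X] [TopologicalSpace Y]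
    (f : C(X, Y)) (y₀ : Y) (hf : ∀ x, f x = y₀) (c : singularCohomology ℂ ℂ Y 2) :
    singularCohomology.map ℂ ℂ f 2 c = 0 := by
  have hfac : f = (ContinuousMap.const PUnit.{1} y₀).comp (ContinuousMap.const X PUnit.unit) := by
    refine ContinuousMap.ext fun x ↦ ?_
    rw [hf x]
    rfl
  have hz : Limits.IsZero (singularCohomology ℂ ℂ PUnit.{1} 2) :=
    singularCochainComplex.isZero_singularCohomology_of_subsingleton' (R := ℂ) (M := ℂ) (by omega)
  haveI := ModuleCat.subsingleton_of_isZero hz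
  rw [hfac, singularCohomology.map_comp, ModuleCat.comp_apply,
    Subsingleton.elim (singularCohomology.map ℂ ℂ (ContinuousMap.const PUnit.{1} y₀) 2 c) 0, map_zero]

/-! ## The two slices of `(ℙⁿ ×_ℂ ℙᵐ)(ℂ)` and the classes they detect -/

section Slices

variable (n m : ℕ)

/-- `fst ∘ (P ↦ (P, Q)) = 𝟙`. [folklore] -/
theorem fst_comp_sliceL (Q : ComplexPoints (projectiveSpace m ℂ)) :
    (AlgPoints.mapContinuous (L := ℂ) (fst (projectiveSpace n ℂ) (projectiveSpace m ℂ))).comp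
      (⟨fun P' ↦ AlgPoints.prodEquiv.symm (P', Q),
          AlgPoints.continuous_prodEquiv_symm.comp (continuous_id.prodMk continuous_const)⟩ :
        C(ComplexPoints (projectiveSpace n ℂ), ComplexPoints (projectiveSpace n ℂ ⊗ projectiveSpace m ℂ))) =
      ContinuousMap.id _ := by
  refine ContinuousMap.ext fun P ↦ ?_
  change AlgPoints.map (fst _ _) (AlgPoints.prodEquiv.symm (P, Q)) = P
  rw [← AlgPoints.prodEquiv_apply_fst, Equiv.apply_symm_apply]

/-- `snd ∘ (P ↦ (P, Q)) = const Q`. [folklore] -/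
theorem snd_comp_sliceL (Q : ComplexPoints (projectiveSpace m ℂ)) (P : ComplexPoints (projectiveSpace n ℂ)) :
    (AlgPoints.mapContinuous (L := ℂ) (snd (projectiveSpace n ℂ) (projectiveSpace m ℂ))).comp
      (⟨fun P' ↦ AlgPoints.prodEquiv.symm (P', Q),
          AlgPoints.continuous_prodEquiv_symm.comp (continuous_id.prodMk continuous_const)⟩ :
        C(ComplexPoints (projectiveSpace n ℂ), ComplexPoints (projectiveSpace n ℂ ⊗ projectiveSpace m ℂ))) P = Q := by
  change AlgPoints.map (snd _ _) (AlgPoints.prodEquiv.symm (P, Q)) = Q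
  rw [← AlgPoints.prodEquiv_apply_snd, Equiv.apply_symm_apply]

/-- `snd ∘ (Q ↦ (P, Q)) = 𝟙`. [folklore] -/
theorem snd_comp_sliceR (P : ComplexPoints (projectiveSpace n ℂ)) :
    (AlgPoints.mapContinuous (L := ℂ) (snd (projectiveSpace n ℂ) (projectiveSpace m ℂ))).comp
      (⟨fun Q' ↦ AlgPoints.prodEquiv.symm (P, Q'),
          AlgPoints.continuous_prodEquiv_symm.comp (continuous_const.prodMk continuous_id)⟩ :
        C(ComplexPoints (projectiveSpace m ℂ), ComplexPoints (projectiveSpace n ℂ ⊗ projectiveSpace m ℂ))) =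
      ContinuousMap.id _ := by
  refine ContinuousMap.ext fun Q ↦ ?_
  change AlgPoints.map (snd _ _) (AlgPoints.prodEquiv.symm (P, Q)) = Q
  rw [← AlgPoints.prodEquiv_apply_snd, Equiv.apply_symm_apply]

/-- `fst ∘ (Q ↦ (P, Q)) = const P`. [folklore] -/
theorem fst_comp_sliceR (P : ComplexPoints (projectiveSpace n ℂ)) (Q : ComplexPoints (projectiveSpace m ℂ)) :
    (AlgPoints.mapContinuous (L := ℂ) (fst (projectiveSpace n ℂ) (projectiveSpace m ℂ))).comp
      (⟨fun Q' ↦ AlgPoints.prodEquiv.symm (P, Q'),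
          AlgPoints.continuous_prodEquiv_symm.comp (continuous_const.prodMk continuous_id)⟩ :
        C(ComplexPoints (projectiveSpace m ℂ), ComplexPoints (projectiveSpace n ℂ ⊗ projectiveSpace m ℂ))) Q = P := by
  change AlgPoints.map (fst _ _) (AlgPoints.prodEquiv.symm (P, Q)) = P
  rw [← AlgPoints.prodEquiv_apply_fst, Equiv.apply_symm_apply]

/-- `dim H²((ℙⁿ × ℙᵐ)(ℂ); ℂ) = b₂(ℙⁿ) + b₂(ℙᵐ)` (Künneth with `b₀ = 1`, `b₁ = 0`).
[cite: HatcherAT2002, §3.2 Thm. 3.16] -/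
theorem finrank_complexBetti_prod_two :
    Module.finrank ℂ (complexBetti (projectiveSpace n ℂ ⊗ projectiveSpace m ℂ) 2) =
      Module.finrank ℂ (complexBetti (projectiveSpace n ℂ) 2) + Module.finrank ℂ (complexBetti (projectiveSpace m ℂ) 2) := by
  rw [finrank_complexBetti_tensor (isSmoothProjective_projectiveSpace' n) (isSmoothProjective_projectiveSpace' m) 2,
    Finset.sum_range_succ, Finset.sum_range_succ, Finset.sum_range_one,
    finrank_complexBetti_projectiveSpace_zero, finrank_complexBetti_projectiveSpace_zero,
    finrank_complexBetti_projectiveSpace_one]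
  simp

/-- **The two slices detect `H²((ℙⁿ × ℙᵐ)(ℂ); ℂ)`**: a degree-two class restricting to zero on
`ℙⁿ × {Q}` and on `{P} × ℙᵐ` is zero (the restriction map to the two slices is onto
`H²(ℙⁿ) ⊕ H²(ℙᵐ)`, and both sides have the same dimension by Künneth). [cite: HatcherAT2002, §3.2 Thm. 3.16] -/
theorem eq_zero_of_slices (P : ComplexPoints (projectiveSpace n ℂ)) (Q : ComplexPoints (projectiveSpace m ℂ))
    (c : complexBetti (projectiveSpace n ℂ ⊗ projectiveSpace m ℂ) 2)
    (hL : singularCohomology.map ℂ ℂ (⟨fun P' ↦ AlgPoints.prodEquiv.symm (P', Q),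
          AlgPoints.continuous_prodEquiv_symm.comp (continuous_id.prodMk continuous_const)⟩ :
        C(ComplexPoints (projectiveSpace n ℂ), ComplexPoints (projectiveSpace n ℂ ⊗ projectiveSpace m ℂ))) 2 c = 0)
    (hR : singularCohomology.map ℂ ℂ (⟨fun Q' ↦ AlgPoints.prodEquiv.symm (P, Q'),
          AlgPoints.continuous_prodEquiv_symm.comp (continuous_const.prodMk continuous_id)⟩ :
        C(ComplexPoints (projectiveSpace m ℂ), ComplexPoints (projectiveSpace n ℂ ⊗ projectiveSpace m ℂ))) 2 c = 0) :
    c = 0 := by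
  set ιL : C(ComplexPoints (projectiveSpace n ℂ), ComplexPoints (projectiveSpace n ℂ ⊗ projectiveSpace m ℂ)) :=
    ⟨fun P' ↦ AlgPoints.prodEquiv.symm (P', Q),
      AlgPoints.continuous_prodEquiv_symm.comp (continuous_id.prodMk continuous_const)⟩ with hιL
  set ιR : C(ComplexPoints (projectiveSpace m ℂ), ComplexPoints (projectiveSpace n ℂ ⊗ projectiveSpace m ℂ)) :=
    ⟨fun Q' ↦ AlgPoints.prodEquiv.symm (P, Q'),
      AlgPoints.continuous_prodEquiv_symm.comp (continuous_const.prodMk continuous_id)⟩ with hιR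
  haveI := finite_complexBetti (isSmoothProjective_projectiveSpace' n) 2
  haveI := finite_complexBetti (isSmoothProjective_projectiveSpace' m) 2
  haveI := finite_complexBetti ((isSmoothProjective_projectiveSpace' n).tensor_holds (isSmoothProjective_projectiveSpace' m)) 2
  let ρ : complexBetti (projectiveSpace n ℂ ⊗ projectiveSpace m ℂ) 2 →ₗ[ℂ]
      complexBetti (projectiveSpace n ℂ) 2 × complexBetti (projectiveSpace m ℂ) 2 :=
    LinearMap.prod (singularCohomology.map ℂ ℂ ιL 2).hom (singularCohomology.map ℂ ℂ ιR 2).hom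
  have hsurj : Function.Surjective ρ := by
    rintro ⟨a, b⟩
    refine ⟨complexBetti.map (fst _ _) 2 a + complexBetti.map (snd _ _) 2 b, ?_⟩
    have h1 : singularCohomology.map ℂ ℂ ιL 2 (complexBetti.map (fst _ _) 2 a) = a := by
      rw [complexBetti.map, ← ModuleCat.comp_apply, ← singularCohomology.map_comp, hιL, fst_comp_sliceL,
        singularCohomology.map_id, ModuleCat.id_apply]
    have h2 : singularCohomology.map ℂ ℂ ιL 2 (complexBetti.map (snd _ _) 2 b) = 0 := by
      rw [complexBetti.map, ← ModuleCat.comp_apply, ← singularCohomology.map_comp]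
      exact map_two_eq_zero_of_factors _ Q (snd_comp_sliceL n m Q) b
    have h3 : singularCohomology.map ℂ ℂ ιR 2 (complexBetti.map (fst _ _) 2 a) = 0 := by
      rw [complexBetti.map, ← ModuleCat.comp_apply, ← singularCohomology.map_comp]
      exact map_two_eq_zero_of_factors _ P (fst_comp_sliceR n m P) a
    have h4 : singularCohomology.map ℂ ℂ ιR 2 (complexBetti.map (snd _ _) 2 b) = b := by
      rw [complexBetti.map, ← ModuleCat.comp_apply, ← singularCohomology.map_comp, hιR, snd_comp_sliceR,
        singularCohomology.map_id, ModuleCat.id_apply]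
    simp only [ρ, LinearMap.prod_apply, map_add]
    change (singularCohomology.map ℂ ℂ ιL 2 _ + singularCohomology.map ℂ ℂ ιL 2 _,
      singularCohomology.map ℂ ℂ ιR 2 _ + singularCohomology.map ℂ ℂ ιR 2 _) = (a, b)
    rw [h1, h2, h3, h4, add_zero, zero_add]
  have hdim : Module.finrank ℂ (complexBetti (projectiveSpace n ℂ ⊗ projectiveSpace m ℂ) 2) =
      Module.finrank ℂ (complexBetti (projectiveSpace n ℂ) 2 × complexBetti (projectiveSpace m ℂ) 2) := by
    rw [Module.finrank_prod, finrank_complexBetti_prod_two]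
  have hinj : Function.Injective ρ := (LinearMap.injective_iff_surjective_of_finrank_eq_finrank hdim).2 hsurj
  refine hinj ?_
  rw [map_zero]
  change (singularCohomology.map ℂ ℂ ιL 2 c, singularCohomology.map ℂ ℂ ιR 2 c) = 0
  rw [hL, hR]
  rfl

end Slices

/-! ## Two rational classes on a line differ by a rational factor -/

/-- **Two rational classes on a line differ by a rational factor**: if `c ≠ 0` and `z • c` are both
rational classes then `z ∈ ℚ` (rational classes satisfying a complex linear relation satisfy a rational
one, `linearIndependent_of_isRationalClass`). [cite: VoisinHodgeI2002, §7.1.1] -/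
theorem exists_ratCast_eq_of_isRationalClass_smul {Y : Type} [TopologicalSpace Y] {k : ℕ}
    {c : singularCohomology ℂ ℂ Y k} (hc : IsRationalClass c) (hc0 : c ≠ 0) {z : ℂ}
    (hz : IsRationalClass (z • c)) : ∃ q : ℚ, (q : ℂ) = z := by
  classical
  by_contra hcon
  push Not at hcon
  have hind : LinearIndependent ℂ ![c, z • c] := by
    refine linearIndependent_of_isRationalClass (fun j ↦ ?_) fun q hq ↦ ?_
    · fin_cases j
      · exact hc
      · exact hz
    · rw [Fin.sum_univ_two] at hq
      simp only [Matrix.cons_val_zero, Matrix.cons_val_one, Matrix.cons_val_fin_one] at hq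
      have h' : ((q 0 : ℂ) + (q 1 : ℂ) * z) • c = 0 := by rw [add_smul, mul_smul, hq]
      have hcoef : (q 0 : ℂ) + (q 1 : ℂ) * z = 0 := (smul_eq_zero.1 h').resolve_right hc0
      by_cases hq1 : q 1 = 0
      · have hq0 : (q 0 : ℂ) = 0 := by rw [hq1, Rat.cast_zero, zero_mul, add_zero] at hcoef; exact hcoef
        funext j
        fin_cases j
        · exact_mod_cast hq0
        · exact hq1
      · exfalso
        refine hcon (-q 0 / q 1) ?_
        have hq1' : ((q 1 : ℚ) : ℂ) ≠ 0 := by exact_mod_cast hq1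
        push_cast
        field_simp
        linear_combination -hcoef
  have h := (LinearIndependent.pair_iff.1 hind) z (-1) (by rw [neg_one_smul, add_neg_cancel])
  exact one_ne_zero (neg_eq_zero.1 h.2)

/-! ## The registered statement (explicit binders) -/

/-- **The two slices detect `H²((ℙⁿ ×_ℂ ℙᵐ)(ℂ); ℂ)`** (explicit form of `eq_zero_of_slices`): a class
`c ∈ H²((ℙⁿ ×_ℂ ℙᵐ)(ℂ); ℂ)` whose restrictions along `P' ↦ (P', Q)` and `Q' ↦ (P, Q')` both vanish is
zero. [cite: HatcherAT2002, §3.2 Thm. 3.16] -/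
theorem segreSlices_detect :
    ∀ (n m : ℕ) (P : ComplexPoints (projectiveSpace n ℂ)) (Q : ComplexPoints (projectiveSpace m ℂ))
      (c : complexBetti (MonoidalCategory.tensorObj (projectiveSpace n ℂ) (projectiveSpace m ℂ)) 2),
      singularCohomology.map ℂ ℂ (⟨fun P' ↦ AlgPoints.prodEquiv.symm (P', Q),
          AlgPoints.continuous_prodEquiv_symm.comp (continuous_id.prodMk continuous_const)⟩ :
        C(ComplexPoints (projectiveSpace n ℂ),
          ComplexPoints (MonoidalCategory.tensorObj (projectiveSpace n ℂ) (projectiveSpace m ℂ)))) 2 c = 0 →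
      singularCohomology.map ℂ ℂ (⟨fun Q' ↦ AlgPoints.prodEquiv.symm (P, Q'),
          AlgPoints.continuous_prodEquiv_symm.comp (continuous_const.prodMk continuous_id)⟩ :
        C(ComplexPoints (projectiveSpace m ℂ),
          ComplexPoints (MonoidalCategory.tensorObj (projectiveSpace n ℂ) (projectiveSpace m ℂ)))) 2 c = 0 →
      c = 0 :=
  fun n m P Q c hL hR ↦ eq_zero_of_slices n m P Q c hL hR

end Summit.HodgeConjecture.HodgeConjecture.Theorems.WeilTwelvefoldsSqrtMinus7.AmnesicSecantSheaves

end
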